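import Literature.NumberTheory.Automorphic.UnitaryGroupOfLocalTorusMeasureKit
import Literature.NumberTheory.Automorphic.UnitaryGroupOfLocalCovolumeStable
import Literature.NumberTheory.Automorphic.UnitaryGroupCovolWeightStable
import Literature.NumberTheory.Automorphic.OrbitalMeasureQuotientOfPointHaarChange
import Literature.NumberTheory.Automorphic.UnitaryGroupOrbitalSumSmul
import Literature.MeasureTheory.Group.RightInvariantIsHaar
import Literature.MeasureTheory.Measure.ProdLeftCancel
import HarnessLib

/-!
# The covolume weights of `U(H)`'s orbital family `ofLocal` are constant on the regular stable classes
# (Rogawski (1990) §4.3 pp. 43–44, §5.4 p. 72, §14.5 pp. 237–238; Langlands–Shelstad (1987) §1.3–1.4)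

Topic `NumberTheory/Automorphic`; namespace `Literature.NumberTheory.Automorphic` (§0) and `….UnitaryGroup` (§1); THEOREMS ONLY (no
definition, no named fact, no `sorry`, no instance, no notation).  Row (O10-c4-b) of the cell's T1 line: the (c4) HEAD
`UnitaryGroup.covol_ofLocal_eq_of_isRegular_of_ofConjClass_eq`, the composition of

* ★ (c4-a) `UnitaryGroup.exists_tower_ofLocal_eq_quotientMeasure` (`UnitaryGroupOfLocalTorusMeasureKit`): at a regular rational class `c`,
  `ofLocal mG mGi c = dν_𝔸 ∕ dt_𝔸` for the adelic torus measure `t_𝔸` of the restricted-product tower built from the canonical local torus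
  measures `t_v` (compact-core mass one) and an archimedean torus measure `t_∞` reading `mGi` against `ν_∞`, `ν_𝔸 = e_* (ν_∞ ⊗ ν_f)`;
* ★ (c4-b)(i) `UnitaryGroup.map_adelicStableCentralizerEquiv_torusMeasure_eq_of_compactCore` (`UnitaryGroupOfLocalCovolumeStable`): two such
  towers at stably conjugate regular `γ ↔ γ′` are carried onto each other by the stable-centraliser isomorphism `e_𝔸 : U(H)(𝔸)_γ ≃ U(H)(𝔸)_{γ′}`
  as soon as the archimedean members are (`(e_∞)_* t_∞ = t′_∞`);
* ★ (AQ-κ) `UnitaryGroup.exists_atPoint_eq_quotientMeasure_of_isQuotientOf_of_archCoherent` (`OrbitalMeasureQuotientOfPointHaarChange`): under the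
  line's pin (xii) (`mGi` is `dνGi ∕ dt′` at the regular classes with `t′` coherent along the archimedean stable-centraliser isomorphisms) the
  archimedean torus measure against ANY Haar `ν_∞` is `haarScalarFactor ν_∞ νGi • t′ γ_∞` — so coherence of `t′` (pin (xii)'s `hC`) transports
  (★ `map_archStableCentralizerEquiv_nnreal_smul_eq`) once `ν_∞` is THE SAME at `c` and `c′`: it is, because `ν_f` is (the restricted product
  measure does not depend on the exceptional set, ★ `rpMeasure_eq_of_subset`, as `ν′_v(U(H)(𝒪_v)) = 1` at EVERY place) and `ν_𝔸 = e_* (ν_∞ ⊗ ν_f)`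
  determines `ν_∞` (★ `Literature.MeasureTheory.Measure.eq_of_map_mulEquiv_prod_eq`, Gelbart's Remark 9.23);
* ★ (c3′) `UnitaryGroup.covol_eq_of_eq_quotientMeasure_of_map_eq` (`UnitaryGroupCovolWeightStable`): coherent torus measures give equal covolumes
  `vol(U(H)(L⁺)_γ \ U(H)(𝔸)_γ)` for the Haar family `νZ` reading the orbital family `m` (`m c = dν_𝔸 ∕ d(νZ c)`), `m = ofLocal` at the regular classes.

§0 supplies two small measure-theoretic letters used on the way: transport along `subgroupCongrHomeomorph` preserves the compact-core mass, and a
non-zero Weil quotient `dν ∕ dρ` has `ν ≠ 0` — whence the archimedean measure `νGi` of pin (xii), bound only as «finite on compacta, right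
invariant», is a Haar measure (★ `Literature.MeasureTheory.Group.isHaarMeasure_of_isMulRightInvariant_of_ne_zero`) as soon as one regular class is
admissible.

## References
* J. Rogawski, *Automorphic representations of unitary groups in three variables*, Ann. of Math. Stud. 123 (1990), §4.3 pp. 43–44 (compatible
  measures on `G_γ`, stable conjugacy of tori), §5.4 p. 72 (the measures in the stabilised elliptic term), §14.5 pp. 237–238 [Rogawski1990].
* R. P. Langlands, D. Shelstad, *On the definition of transfer factors*, Math. Ann. 278 (1987), §1.3–§1.4 (inner twists of tori and the transport
  of measures) [LanglandsShelstad1987].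
* A. Deitmar, S. Echterhoff, *Principles of Harmonic Analysis*, 2nd ed. (2014), Thm. 1.5.3 (Weil's quotient integral formula) [DeitmarEchterhoff2014].
* S. Gelbart, *Automorphic forms on adele groups* (1975), Remark 9.23, p. 155 (10.19) [Gelbart1975].
-/

set_option autoImplicit false

noncomputable section

open _root_.MeasureTheory _root_.MeasureTheory.Measure Set Filter Function NumberField IsDedekindDomain
open _root_.Topology
open Literature.Topology.RestrictedProduct Literature.Topology.Algebra.RestrictedProduct Literature.MeasureTheory.Group
open Literature.MeasureTheory.RestrictedProduct Literature.NumberTheory.Rogawski1990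
open scoped RestrictedProduct ENNReal NNReal Pointwise Matrix


namespace Literature.NumberTheory.Automorphic

/-! ## §0 Two measure-theoretic letters -/

section CompactCoreTransport

variable {G G' : Type*} [Group G] [Group G'] [TopologicalSpace G] [TopologicalSpace G']
  [MeasurableSpace G] [BorelSpace G] [MeasurableSpace G'] [BorelSpace G']
  (e : G ≃* G') (he : Continuous e) (hes : Continuous e.symm)
  (H : Subgroup G) (H' : Subgroup G') (hHH' : ∀ g, e g ∈ H' ↔ g ∈ H)

/-- **Transport along `subgroupCongrHomeomorph` preserves the compact-core mass**: `((e|)_* t)(compactCore H′) = t(compactCore H)` (the restriction of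
`e` to `H ≃ H′` is an isomorphism of topological groups, ★ `image_compactCore`; outer measures, no measurability needed). [cite: Rogawski1990, §4.3 p. 43] -/
theorem map_subgroupCongrHomeomorph_apply_compactCore (t : Measure H) :
    Measure.map (subgroupCongrHomeomorph e H H' hHH' he hes) t (compactCore H') = t (compactCore H) := by
  let eZ : H ≃ₜ* H' :=
    { toMulEquiv :=
        { toEquiv := (subgroupCongrHomeomorph e H H' hHH' he hes).toEquiv
          map_mul' := fun a b => Subtype.ext (map_mul e (a : G) (b : G)) }
      continuous_toFun := (subgroupCongrHomeomorph e H H' hHH' he hes).continuous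
      continuous_invFun := (subgroupCongrHomeomorph e H H' hHH' he hes).symm.continuous }
  have hco : (⇑(subgroupCongrHomeomorph e H H' hHH' he hes) : H → H') = ⇑((subgroupCongrHomeomorph e H H' hHH' he hes).toMeasurableEquiv) := rfl
  have heZ : (⇑eZ : H → H') = ⇑(subgroupCongrHomeomorph e H H' hHH' he hes) := rfl
  have hpre : ⇑(subgroupCongrHomeomorph e H H' hHH' he hes) ⁻¹' compactCore H' = compactCore H := by
    rw [← heZ, ← image_compactCore eZ]; exact eZ.injective.preimage_image _
  rw [hco, MeasurableEquiv.map_apply, ← hco, hpre]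

end CompactCoreTransport



section QuotientZero

open Literature.MeasureTheory.Group CompactlySupported

variable {G : Type*} [Group G] [TopologicalSpace G] [IsTopologicalGroup G] [LocallyCompactSpace G]
  [SecondCountableTopology G] [T2Space G] [MeasurableSpace G] [BorelSpace G]
  (Z : Subgroup G) (hZ : IsClosed (Z : Set G)) [MeasurableSpace (G ⧸ Z)] [BorelSpace (G ⧸ Z)]
  (ρ : Measure Z) [ρ.IsMulLeftInvariant] [IsFiniteMeasureOnCompacts ρ] [ρ.IsOpenPosMeasure] [ρ.IsInvInvariant]

/-- **Weil's quotient of the ZERO measure is zero**: if `ν = 0` then `quotientMeasure Z ρ ν = 0` (its Riesz functional vanishes; the Riesz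
measure of a vanishing functional gives every compact set mass `0` — Mathlib `RealRMK.rieszMeasure_le_of_eq_one` with a compactly supported `f = 1` on
the compact, `exists_continuousMap_one_of_isCompact_subset_isOpen` — and is regular, `IsOpen.measure_eq_iSup_isCompact`). [cite: DeitmarEchterhoff2014, Thm. 1.5.3] -/
theorem quotientMeasure_eq_zero_of_eq_zero (ν : Measure G) [IsFiniteMeasureOnCompacts ν] [ν.IsMulRightInvariant] (hν : ν = 0) :
    quotientMeasure Z ρ hZ ν = 0 := by
  haveI : IsClosed (Z : Set G) := hZ
  change RealRMK.rieszMeasure (quotientFunctional Z ρ hZ ν) = 0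
  have hΛ0 : ∀ F : C_c(G ⧸ Z, ℝ), quotientFunctional Z ρ hZ ν F = 0 := fun F => by
    rw [quotientFunctional_apply, hν, integral_zero_measure]
  have hK : ∀ K : Set (G ⧸ Z), IsCompact K → RealRMK.rieszMeasure (quotientFunctional Z ρ hZ ν) K = 0 := by
    intro K hK
    obtain ⟨f, hf1, hfc, -, hf01⟩ := exists_continuousMap_one_of_isCompact_subset_isOpen hK isOpen_univ (Set.subset_univ K)
    have h := RealRMK.rieszMeasure_le_of_eq_one (quotientFunctional Z ρ hZ ν) (f := ⟨f, hfc⟩) (fun x => (hf01 x).1) hK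
      (fun x hx => hf1 hx)
    rw [hΛ0, ENNReal.ofReal_zero] at h
    exact le_antisymm h bot_le
  refine Measure.measure_univ_eq_zero.mp ?_
  rw [isOpen_univ.measure_eq_iSup_isCompact]
  exact ENNReal.iSup_eq_zero.mpr fun K => ENNReal.iSup_eq_zero.mpr fun _ => ENNReal.iSup_eq_zero.mpr fun hKc => hK K hKc

/-- **A non-zero Weil quotient has a non-zero ambient measure**: if `m = quotientMeasure Z ρ ν` and `m ≠ 0` then `ν ≠ 0` — used to see that the
archimedean Haar-type measure of the T1 line's pin (xii), bound only as «finite on compacta, right invariant», is non-zero (hence Haar, ★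
`isHaarMeasure_of_isMulRightInvariant_of_ne_zero`) as soon as ONE admissible class reads `dν ∕ dt`. [cite: DeitmarEchterhoff2014, Thm. 1.5.3] -/
theorem ne_zero_of_quotientMeasure_ne_zero (ν : Measure G) [IsFiniteMeasureOnCompacts ν] [ν.IsMulRightInvariant]
    {m : Measure (G ⧸ Z)} (hm : m = quotientMeasure Z ρ hZ ν) (hm0 : m ≠ 0) : ν ≠ 0 :=
  fun hν => hm0 (hm.trans (quotientMeasure_eq_zero_of_eq_zero Z hZ ρ ν hν))

end QuotientZero

/-! ## §1 The (c4) head -/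

namespace UnitaryGroup

open Literature.AlgebraicGeometry.ShimuraVarieties (hermForm)

section Head

variable (L : Type) [Field L] [NumberField L] [IsCMField L] (N : ℕ) (H : Matrix (Fin N) (Fin N) L)
  [∀ g : (cmDatum L N H).Adelic, MeasurableSpace ((cmDatum L N H).Adelic ⧸ Subgroup.centralizer ({g} : Set (cmDatum L N H).Adelic))]
  [∀ g : (cmDatum L N H).Adelic, BorelSpace ((cmDatum L N H).Adelic ⧸ Subgroup.centralizer ({g} : Set (cmDatum L N H).Adelic))]
  [∀ a : (arch (↥(maximalRealSubfield L)) L (IsCMField.complexConj L) N H), MeasurableSpace ((arch (↥(maximalRealSubfield L)) L (IsCMField.complexConj L) N H) ⧸ Subgroup.centralizer ({a} : Set (arch (↥(maximalRealSubfield L)) L (IsCMField.complexConj L) N H)))]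
  [∀ a : (arch (↥(maximalRealSubfield L)) L (IsCMField.complexConj L) N H), BorelSpace ((arch (↥(maximalRealSubfield L)) L (IsCMField.complexConj L) N H) ⧸ Subgroup.centralizer ({a} : Set (arch (↥(maximalRealSubfield L)) L (IsCMField.complexConj L) N H)))]
  [∀ (v : HeightOneSpectrum (𝓞 ↥(maximalRealSubfield L))) (x : (cmDatum L N H).Local v),
    MeasurableSpace ((cmDatum L N H).Local v ⧸ Subgroup.centralizer ({x} : Set ((cmDatum L N H).Local v)))]
  [∀ (v : HeightOneSpectrum (𝓞 ↥(maximalRealSubfield L))) (x : (cmDatum L N H).Local v),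
    BorelSpace ((cmDatum L N H).Local v ⧸ Subgroup.centralizer ({x} : Set ((cmDatum L N H).Local v)))]
  [∀ v, MeasurableSpace ((cmDatum L N H).Local v)] [∀ v, BorelSpace ((cmDatum L N H).Local v)]
  [MeasurableSpace (cmDatum L N H).Adelic] [BorelSpace (cmDatum L N H).Adelic]
  [MeasurableSpace (arch (↥(maximalRealSubfield L)) L (IsCMField.complexConj L) N H)] [BorelSpace (arch (↥(maximalRealSubfield L)) L (IsCMField.complexConj L) N H)]
  -- the lattice-side families of ★ `UnitaryGroupDiagTraceExplicitWeights` §3 ∕ ★ `UnitaryGroupCovolWeightStable`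
  [∀ γ : (cmDatum L N H).Adelic, MeasurableSpace (↥(Subgroup.centralizer ({γ} : Set (cmDatum L N H).Adelic)) ⧸
    ((cmDatum L N H).quotientSubgroup ⊓ Subgroup.centralizer ({γ} : Set (cmDatum L N H).Adelic)).subgroupOf
      (Subgroup.centralizer ({γ} : Set (cmDatum L N H).Adelic)))]
  [∀ γ : (cmDatum L N H).Adelic, BorelSpace (↥(Subgroup.centralizer ({γ} : Set (cmDatum L N H).Adelic)) ⧸
    ((cmDatum L N H).quotientSubgroup ⊓ Subgroup.centralizer ({γ} : Set (cmDatum L N H).Adelic)).subgroupOf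
      (Subgroup.centralizer ({γ} : Set (cmDatum L N H).Adelic)))]
  [hCcl : ∀ γ : (cmDatum L N H).Adelic, IsClosed ((Subgroup.centralizer ({γ} : Set (cmDatum L N H).Adelic) :
    Subgroup (cmDatum L N H).Adelic) : Set (cmDatum L N H).Adelic)]
  [∀ γ : (cmDatum L N H).Adelic, (count : Measure ↥(((cmDatum L N H).quotientSubgroup ⊓
    Subgroup.centralizer ({γ} : Set (cmDatum L N H).Adelic)).subgroupOf
      (Subgroup.centralizer ({γ} : Set (cmDatum L N H).Adelic)))).IsHaarMeasure]

set_option maxHeartbeats 16000000 in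
set_option synthInstance.maxHeartbeats 800000 in
-- HB: the two instantiations of ★ (c4-a) `exists_tower_ofLocal_eq_quotientMeasure` (27 instance facts, 14 equations over the concrete
-- restricted-product carriers each) dominate; the STATEMENT elaborates at default heartbeats (consumer `example` certified separately).
/-- **THE (O10-c4) HEAD — the covolume weights of `ofLocal` are CONSTANT ON THE REGULAR STABLE CLASSES.**  `H` hermitian, non-degenerate,
anisotropic; `ν_v` Haar, right invariant, `ν_v(U(H)(𝒪_v)) = 1`; `mG v` canonical on the regular classes for `ν_v` (pin (xi‴)); `mGi` any archimedean
family with pin (xii): `mGi [γ_∞] = dνGi ∕ d(t′ γ_∞)` at the regular classes (`hW`, `νGi` finite on compacta and right invariant) with `t′` coherent along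
the archimedean stable-centraliser isomorphisms (`hC`), admissible on the regular classes (`hadmA`); `ν_𝔸` Haar; `m` an adelic orbital family EQUAL TO
`ofLocal mG mGi` at the regular classes (`hmreg`) and read as `dν_𝔸 ∕ d(νZ c)` for a Haar family `νZ` (`hm`, ★ (O10-c1)).  THEN for regular classes `c, c′`
in the same stable class the covolumes `vol(U(H)(L⁺)_{γ_c} \ U(H)(𝔸)_{γ_c} ; νZ c)` and `vol(U(H)(L⁺)_{γ_{c′}} \ U(H)(𝔸)_{γ_{c′}} ; νZ c′)` coincide — the `hstab`
input of ★ (c5) `exists_absorbedFamily_stableCovolWeight`.  Binder order is the consumer's positional one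
(`L N H hanis hH hHd ν hK mG hcan mGi νGi t' hW hC hadmA νA m hmreg νZ hm c c' hc hc' hst`); the only instance binders are the σ-algebras on
`U(H)(𝔸)`, `U(H)(L⁺_v)`, `U(H)_∞`, the three orbit-quotient families, the lattice-quotient family, `hCcl` and the counting Haar family.
[cite: Rogawski1990, §4.3 pp. 43–44; §5.4 p. 72; §14.5 pp. 237–238] [cite: LanglandsShelstad1987, §1.3–§1.4] -/
theorem covol_ofLocal_eq_of_isRegular_of_ofConjClass_eq
    (hanis : ∀ x : Fin N → L, hermForm (cmConjRingHom L) H x x = 0 → x = 0)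
    (hH : (H.map (cmConjRingHom L))ᵀ = H) (hHd : H.det ≠ 0)
    (ν : ∀ v, Measure ((cmDatum L N H).Local v)) [∀ v, IsHaarMeasure (ν v)] [∀ v, (ν v).IsMulRightInvariant]
    (hK : ∀ v, ν v (cmLocalIntegralLevel L N H v : Set ((cmDatum L N H).Local v)) = 1)
    (mG : ∀ v : HeightOneSpectrum (𝓞 ↥(maximalRealSubfield L)), OrbitalMeasureFamily ((cmDatum L N H).Local v))
    (hcan : ∀ v, (mG v).IsCanonical (fun x => IsRegularElt (x.val : GL (Fin N) (LocalRing L v))) (ν v))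
    (mGi : OrbitalMeasureFamily (arch (↥(maximalRealSubfield L)) L (IsCMField.complexConj L) N H))
    (νGi : Measure (arch (↥(maximalRealSubfield L)) L (IsCMField.complexConj L) N H)) [IsFiniteMeasureOnCompacts νGi] [νGi.IsMulRightInvariant]
    (t' : ∀ γ' : arch (↥(maximalRealSubfield L)) L (IsCMField.complexConj L) N H, Measure (Subgroup.centralizer ({γ'} : Set _)))
    (hW : mGi.IsQuotientOf (fun γ => IsRegularElt (γ.val : GL (Fin N) (mixedEmbedding.mixedSpace L))) νGi t')
    (hC : ∀ (γ₁ γ₂ : arch (↥(maximalRealSubfield L)) L (IsCMField.complexConj L) N H)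
        (h₁ : IsRegularElt (γ₁.val : GL (Fin N) (mixedEmbedding.mixedSpace L)))
        (hc : Corresponds (conjMixed (↥(maximalRealSubfield L)) L (IsCMField.complexConj L)) (archFormOf L N H) (archFormOf L N H) γ₁ γ₂),
        Measure.map (archStableCentralizerEquiv L hHd hHd hc h₁) (t' γ₁) = t' γ₂)
    (hadmA : mGi.IsAdmissibleOn (fun γ => IsRegularElt (γ.val : GL (Fin N) (mixedEmbedding.mixedSpace L))))
    (νA : Measure (cmDatum L N H).Adelic) [νA.IsHaarMeasure] [νA.IsMulRightInvariant]
    (m : AdelicOrbitalMeasureFamily L N H)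
    (hmreg : ∀ c : ConjClasses (cmDatum L N H).Rational, IsRegularElt ((Quotient.out c).val : GL (Fin N) L) →
      m c = AdelicOrbitalMeasureFamily.ofLocal L N H mG mGi c)
    (νZ : ∀ c : ConjClasses (cmDatum L N H).Rational,
      Measure ↥(Subgroup.centralizer ({(cmDatum L N H).toAdelic (Quotient.out c)} : Set (cmDatum L N H).Adelic)))
    [∀ c, IsHaarMeasure (νZ c)] [∀ c, (νZ c).IsMulRightInvariant] [∀ c, (νZ c).IsInvInvariant]
    (hm : ∀ c, m c = quotientMeasure (Subgroup.centralizer ({(cmDatum L N H).toAdelic (Quotient.out c)} : Set (cmDatum L N H).Adelic))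
      (νZ c) (hCcl _) νA)
    (c c' : ConjClasses (cmDatum L N H).Rational)
    (hc : IsRegularElt ((Quotient.out c).val : GL (Fin N) L)) (hc' : IsRegularElt ((Quotient.out c').val : GL (Fin N) L))
    (hst : StableClass.ofConjClass c = StableClass.ofConjClass c') :
    quotientMeasure (((cmDatum L N H).quotientSubgroup ⊓
        Subgroup.centralizer ({(cmDatum L N H).toAdelic (Quotient.out c)} : Set (cmDatum L N H).Adelic)).subgroupOf
        (Subgroup.centralizer ({(cmDatum L N H).toAdelic (Quotient.out c)} : Set (cmDatum L N H).Adelic))) count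
        (isClosed_subgroupOf _ _ ((isClosed_cmDatum_quotientSubgroup L N H).inter (hCcl _))) (νZ c) Set.univ =
      quotientMeasure (((cmDatum L N H).quotientSubgroup ⊓
        Subgroup.centralizer ({(cmDatum L N H).toAdelic (Quotient.out c')} : Set (cmDatum L N H).Adelic)).subgroupOf
        (Subgroup.centralizer ({(cmDatum L N H).toAdelic (Quotient.out c')} : Set (cmDatum L N H).Adelic))) count
        (isClosed_subgroupOf _ _ ((isClosed_cmDatum_quotientSubgroup L N H).inter (hCcl _))) (νZ c') Set.univ := by
  classical
  -- the model-side σ-algebras (Borel; not binders of the head — the T1 line's MAIN cannot supply them)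
  letI : ∀ v, MeasurableSpace ↥(localPi L (IsCMField.complexConj L) N H v) := fun _ => borel _
  haveI : ∀ v, BorelSpace ↥(localPi L (IsCMField.complexConj L) N H v) := fun _ => ⟨rfl⟩
  letI : MeasurableSpace (finAdelic (↥(maximalRealSubfield L)) L (IsCMField.complexConj L) N H) := borel _
  haveI : BorelSpace (finAdelic (↥(maximalRealSubfield L)) L (IsCMField.complexConj L) N H) := ⟨rfl⟩
  -- §0 ambient instances (as in ★ (c4-a))
  haveI : Countable (HeightOneSpectrum (𝓞 ↥(maximalRealSubfield L))) := countable_heightOneSpectrum ↥(maximalRealSubfield L)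
  haveI : ∀ v, SecondCountableTopology ↥(localPi L (IsCMField.complexConj L) N H v) := fun v => secondCountableTopology_localPi L N (IsCMField.complexConj L) H v
  haveI : ∀ v, LocallyCompactSpace ↥(localPi L (IsCMField.complexConj L) N H v) := fun v => locallyCompactSpace_localPi L N (IsCMField.complexConj L) H v
  haveI : LocallyCompactSpace (finAdelic (↥(maximalRealSubfield L)) L (IsCMField.complexConj L) N H) := locallyCompactSpace_finAdelic (↥(maximalRealSubfield L)) L (IsCMField.complexConj L) N H
  haveI : SecondCountableTopology (finAdelic (↥(maximalRealSubfield L)) L (IsCMField.complexConj L) N H) := secondCountableTopology_finAdelic (↥(maximalRealSubfield L)) L (IsCMField.complexConj L) N H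
  haveI : T2Space (finAdelic (↥(maximalRealSubfield L)) L (IsCMField.complexConj L) N H) := t2Space_finAdelic (↥(maximalRealSubfield L)) L (IsCMField.complexConj L) N H
  haveI : LocallyCompactSpace (cmDatum L N H).Adelic := locallyCompactSpace_cmDatum_Adelic L N H
  haveI : SecondCountableTopology (cmDatum L N H).Adelic := secondCountableTopology_cmDatum_Adelic L N H
  haveI : T2Space (cmDatum L N H).Adelic := t2Space_cmDatum_Adelic L N H
  haveI hKc : ∀ v, CompactSpace (localInt L (IsCMField.complexConj L) N H v) := fun v => isCompact_iff_compactSpace.1 (isCompact_localInt L (IsCMField.complexConj L) N H v)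
  haveI : BorelSpace (Πʳ v : HeightOneSpectrum (𝓞 ↥(maximalRealSubfield L)), [↥(localPi L (IsCMField.complexConj L) N H v), localInt L (IsCMField.complexConj L) N H v]) :=
    borelSpace (fun v => (localInt L (IsCMField.complexConj L) N H v : Set ↥(localPi L (IsCMField.complexConj L) N H v))) fun v => (isOpen_localInt L (IsCMField.complexConj L) N H v).measurableSet
  haveI : SecondCountableTopology (Πʳ v : HeightOneSpectrum (𝓞 ↥(maximalRealSubfield L)), [↥(localPi L (IsCMField.complexConj L) N H v), localInt L (IsCMField.complexConj L) N H v]) :=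
    secondCountableTopology (fun v => (localInt L (IsCMField.complexConj L) N H v : Set ↥(localPi L (IsCMField.complexConj L) N H v))) fun v => isOpen_localInt L (IsCMField.complexConj L) N H v
  haveI hLCa : ∀ a : arch (↥(maximalRealSubfield L)) L (IsCMField.complexConj L) N H, LocallyCompactSpace (Subgroup.centralizer ({a} : Set (arch (↥(maximalRealSubfield L)) L (IsCMField.complexConj L) N H))) :=
    fun a => (isClosed_coe_centralizer_singleton a).isClosedEmbedding_subtypeVal.locallyCompactSpace
  haveI hLCm : ∀ v, LocallyCompactSpace (Subgroup.centralizer ({(finAdelicEquiv (↥(maximalRealSubfield L)) L (IsCMField.complexConj L) N H) (finPart (↥(maximalRealSubfield L)) L (IsCMField.complexConj L) N H ((cmDatum L N H).toAdelic (Quotient.out c))) v} : Set ↥(localPi L (IsCMField.complexConj L) N H v))) :=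
    fun v => (isClosed_coe_centralizer_singleton _).isClosedEmbedding_subtypeVal.locallyCompactSpace
  haveI hLCm' : ∀ v, LocallyCompactSpace (Subgroup.centralizer ({(finAdelicEquiv (↥(maximalRealSubfield L)) L (IsCMField.complexConj L) N H) (finPart (↥(maximalRealSubfield L)) L (IsCMField.complexConj L) N H ((cmDatum L N H).toAdelic (Quotient.out c'))) v} : Set ↥(localPi L (IsCMField.complexConj L) N H v))) :=
    fun v => (isClosed_coe_centralizer_singleton _).isClosedEmbedding_subtypeVal.locallyCompactSpace
  -- the model identifications, bound as DATA with their equations (the carriers stay syntactic: `cmDatum` is not reducible, so the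
  -- σ-algebra binders on `(cmDatum L N H).Local v` ∕ `.Adelic` are only found through the `cmDatum` spelling)
  obtain ⟨ψ, hψ⟩ : ∃ ψ : ∀ v, ↥(localPi L (IsCMField.complexConj L) N H v) ≃ₜ* (cmDatum L N H).Local v,
      ψ = fun v => localPiEquiv L (IsCMField.complexConj L) N H v := ⟨_, rfl⟩
  obtain ⟨e, he'⟩ : ∃ e : (arch (↥(maximalRealSubfield L)) L (IsCMField.complexConj L) N H) × (finAdelic (↥(maximalRealSubfield L)) L (IsCMField.complexConj L) N H) ≃* (cmDatum L N H).Adelic,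
      e = (adelicProdEquiv (↥(maximalRealSubfield L)) L (IsCMField.complexConj L) N H).symm.toMulEquiv := ⟨_, rfl⟩
  have he : Continuous e := by rw [he']; exact (adelicProdEquiv (↥(maximalRealSubfield L)) L (IsCMField.complexConj L) N H).symm.continuous
  have hes : Continuous e.symm := by rw [he']; exact (adelicProdEquiv (↥(maximalRealSubfield L)) L (IsCMField.complexConj L) N H).continuous
  have hg : ∀ g : (cmDatum L N H).Adelic, e (archPart (↥(maximalRealSubfield L)) L (IsCMField.complexConj L) N H g, finPart (↥(maximalRealSubfield L)) L (IsCMField.complexConj L) N H g) = g := fun g => by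
    rw [he']; exact adelicProdEquiv_symm_archPart_finPart L N H g
  -- §1 the representatives are stably conjugate; regularity and correspondence at `∞`
  have hcorr : Corresponds (cmConjRingHom L) H H (Quotient.out c : (cmDatum L N H).Rational) (Quotient.out c' : (cmDatum L N H).Rational) :=
    corresponds_self_iff.mpr (StableClass.ofConjClass_eq_ofConjClass_iff_isStablyConj_out.mp hst)
  have hreginf : IsRegularElt ((archPart (↥(maximalRealSubfield L)) L (IsCMField.complexConj L) N H ((cmDatum L N H).toAdelic (Quotient.out c))).val : GL (Fin N) (mixedEmbedding.mixedSpace L)) :=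
    isRegularElt_archPart_toAdelic L H (Quotient.out c) hc
  have hreginf' : IsRegularElt ((archPart (↥(maximalRealSubfield L)) L (IsCMField.complexConj L) N H ((cmDatum L N H).toAdelic (Quotient.out c'))).val : GL (Fin N) (mixedEmbedding.mixedSpace L)) :=
    isRegularElt_archPart_toAdelic L H (Quotient.out c') hc'
  have hcinf : Corresponds (conjMixed (↥(maximalRealSubfield L)) L (IsCMField.complexConj L)) (archFormOf L N H) (archFormOf L N H)
      (archPart (↥(maximalRealSubfield L)) L (IsCMField.complexConj L) N H ((cmDatum L N H).toAdelic (Quotient.out c))) (archPart (↥(maximalRealSubfield L)) L (IsCMField.complexConj L) N H ((cmDatum L N H).toAdelic (Quotient.out c'))) := by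
    rw [archPart_cmDatum_toAdelic, archPart_cmDatum_toAdelic]
    exact corresponds_cmRationalToArch hcorr
  -- §2 `νGi` is a Haar measure: it is non-zero because ONE regular class reads `dνGi ∕ dt'` (pin (xii)) and is admissible
  have hνGi0 : νGi ≠ 0 := by
    obtain ⟨h1, h2, hq⟩ := hW (ConjClasses.mk (archPart (↥(maximalRealSubfield L)) L (IsCMField.complexConj L) N H ((cmDatum L N H).toAdelic (Quotient.out c)))) (isRegularElt_out_mk_archPart_toAdelic L H (Quotient.out c) hc)
    exact ne_zero_of_quotientMeasure_ne_zero _ (isClosed_coe_centralizer_singleton _) _ νGi hq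
      (hadmA.at_mk _ (isRegularElt_out_mk_archPart_toAdelic L H (Quotient.out c) hc)).1
  haveI : (haar : Measure (arch (↥(maximalRealSubfield L)) L (IsCMField.complexConj L) N H)).IsMulRightInvariant :=
    isMulRightInvariant_of_modularCharacterFun_eq_one (modularCharacterFun_arch_eq_one L H hH hHd) _
  haveI : νGi.IsHaarMeasure := isHaarMeasure_of_isMulRightInvariant_of_ne_zero haar νGi hνGi0
  -- §3 the towers of ★ (c4-a) at `c` and at `c'` (model data `ψ_v := localPiEquiv`, `e := adelicProdEquiv⁻¹`)
  have hν1 : ∀ v, (Measure.map (ψ v).symm (ν v)) (localInt L (IsCMField.complexConj L) N H v : Set ↥(localPi L (IsCMField.complexConj L) N H v)) = 1 :=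
    fun v => map_localPiEquiv_symm_apply_localInt_eq_one v (ψ v) (congrFun hψ v) (ν v) (hK v)
  haveI hν'H : ∀ v, IsHaarMeasure (Measure.map (ψ v).symm (ν v)) := fun v => isHaarMeasure_map_localModel_symm v (ψ v) (ν v)
  obtain ⟨S₁, t₁, νi₁, ti₁, νrp₁, ρ₁, ρM₁, νf₁, tf₁, tP₁, tA₁, htH₁, htI₁, hνiH₁, hνiR₁, htiH₁, htiI₁, a1, a2, a3, a4, a5, a6, a7, a8, a9, a10, a11, a12, a13, a14, a15, a16, a17, a18, a19, a20, a21, ht1c₁, hat₁, hti₁, hnorm₁, ht1₁, hνrp₁, hρ₁, hρM₁, hνf₁, htf₁, htP₁, htA₁, hνA₁, hof₁⟩ :=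
    exists_tower_ofLocal_eq_quotientMeasure L N H mG mGi c hanis hH hHd ν hK hcan hc νA
      (fun νi _ _ => by
        obtain ⟨ti, h1, h2, h3, -⟩ :=
          exists_atPoint_eq_quotientMeasure_of_isQuotientOf_of_archCoherent L hHd hW hC νi _ hreginf
        exact ⟨ti, h1, h2, h3⟩)
      ψ hψ
      (forall_apply_mem_centralizer_singleton_iff_of_eq (finAdelicEquiv (↥(maximalRealSubfield L)) L (IsCMField.complexConj L) N H).symm.toMulEquiv
        ((finAdelicEquiv (↥(maximalRealSubfield L)) L (IsCMField.complexConj L) N H).symm_apply_apply (finPart (↥(maximalRealSubfield L)) L (IsCMField.complexConj L) N H ((cmDatum L N H).toAdelic (Quotient.out c)))))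
      e he' he hes (hg _)
  obtain ⟨S₂, t₂, νi₂, ti₂, νrp₂, ρ₂, ρM₂, νf₂, tf₂, tP₂, tA₂, htH₂, htI₂, hνiH₂, hνiR₂, htiH₂, htiI₂, b1, b2, b3, b4, b5, b6, b7, b8, b9, b10, b11, b12, b13, b14, b15, b16, b17, b18, b19, b20, b21, ht1c₂, hat₂, hti₂, hnorm₂, ht1₂, hνrp₂, hρ₂, hρM₂, hνf₂, htf₂, htP₂, htA₂, hνA₂, hof₂⟩ :=
    exists_tower_ofLocal_eq_quotientMeasure L N H mG mGi c' hanis hH hHd ν hK hcan hc' νA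
      (fun νi _ _ => by
        obtain ⟨ti, h1, h2, h3, -⟩ :=
          exists_atPoint_eq_quotientMeasure_of_isQuotientOf_of_archCoherent L hHd hW hC νi _ hreginf'
        exact ⟨ti, h1, h2, h3⟩)
      ψ hψ
      (forall_apply_mem_centralizer_singleton_iff_of_eq (finAdelicEquiv (↥(maximalRealSubfield L)) L (IsCMField.complexConj L) N H).symm.toMulEquiv
        ((finAdelicEquiv (↥(maximalRealSubfield L)) L (IsCMField.complexConj L) N H).symm_apply_apply (finPart (↥(maximalRealSubfield L)) L (IsCMField.complexConj L) N H ((cmDatum L N H).toAdelic (Quotient.out c')))))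
      e he' he hes (hg _)
  have htT₁ := fun v => isHaarMeasure_torusTransport L N H v ((cmDatum L N H).toAdelic (Quotient.out c)) (ψ v) (congrFun hψ v) (t₁ v)
  have htT₂ := fun v => isHaarMeasure_torusTransport L N H v ((cmDatum L N H).toAdelic (Quotient.out c')) (ψ v) (congrFun hψ v) (t₂ v)
  -- §4 `ν_f` does not depend on the class (★ `rpMeasure_eq_of_subset`: `ν′_v(K_v) = 1` at EVERY place), hence neither does `ν_∞` (★ `eq_of_map_mulEquiv_prod_eq`)
  have hrp : rpMeasure (fun v => (localInt L (IsCMField.complexConj L) N H v : Set ↥(localPi L (IsCMField.complexConj L) N H v)))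
        (fun v => (Measure.map (ψ v).symm (ν v))) S₁ =
      rpMeasure (fun v => (localInt L (IsCMField.complexConj L) N H v : Set ↥(localPi L (IsCMField.complexConj L) N H v)))
        (fun v => (Measure.map (ψ v).symm (ν v))) S₂ :=
    (rpMeasure_eq_of_subset (fun v => (localInt L (IsCMField.complexConj L) N H v : Set ↥(localPi L (IsCMField.complexConj L) N H v))) (fun v => (Measure.map (ψ v).symm (ν v))) (fun v => ⟨1, one_mem _⟩) (fun v => (isOpen_localInt L (IsCMField.complexConj L) N H v).measurableSet)
        (S₀' := S₁ ∪ S₂) Finset.subset_union_left (fun v _ => hν1 v)).trans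
      (rpMeasure_eq_of_subset (fun v => (localInt L (IsCMField.complexConj L) N H v : Set ↥(localPi L (IsCMField.complexConj L) N H v))) (fun v => (Measure.map (ψ v).symm (ν v))) (fun v => ⟨1, one_mem _⟩) (fun v => (isOpen_localInt L (IsCMField.complexConj L) N H v).measurableSet)
        (S₀' := S₁ ∪ S₂) Finset.subset_union_right (fun v _ => hν1 v)).symm
  have hνf : νf₁ = νf₂ := by rw [hνf₁, hνf₂, hνrp₁, hνrp₂, hrp]
  have hf0 : νf₂ ≠ 0 := measure_univ_ne_zero.mp (isOpen_univ.measure_pos (μ := νf₂) univ_nonempty).ne'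
  have hνi : νi₁ = νi₂ := by
    refine Literature.MeasureTheory.Measure.eq_of_map_mulEquiv_prod_eq e he hes hf0 ?_
    rw [← hνA₂, ← hνf, ← hνA₁]
  subst νi₂
  -- §5 the archimedean torus measures are `κ • t'` with ONE `κ = haarScalarFactor ν_∞ νGi` (★ (AQ-κ) + ★ `isHaarMeasure_eq_of_quotientMeasure_eq`), hence coherent (pin (xii))
  obtain ⟨si₁, hsi₁H, hsi₁I, hq₁, hsi₁⟩ := exists_atPoint_eq_quotientMeasure_of_isQuotientOf_of_archCoherent L hHd hW hC νi₁ _ hreginf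
  obtain ⟨si₂, hsi₂H, hsi₂I, hq₂, hsi₂⟩ := exists_atPoint_eq_quotientMeasure_of_isQuotientOf_of_archCoherent L hHd hW hC νi₁ _ hreginf'
  have he₁ : ti₁ = si₁ :=
    isHaarMeasure_eq_of_quotientMeasure_eq (hH := isClosed_coe_centralizer_singleton _) _ νi₁ ti₁ si₁ (hti₁.symm.trans hq₁)
  have he₂ : ti₂ = si₂ :=
    isHaarMeasure_eq_of_quotientMeasure_eq (hH := isClosed_coe_centralizer_singleton _) _ νi₁ ti₂ si₂ (hti₂.symm.trans hq₂)
  have ha : Measure.map (archStableCentralizerEquiv L hHd hHd hcinf hreginf) ti₁ = ti₂ := by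
    rw [he₁, he₂, hsi₁, hsi₂]
    exact map_archStableCentralizerEquiv_nnreal_smul_eq L N hHd hcinf hreginf _ _ (hC _ _ hreginf hcinf) _
  -- §6 the adelic torus measures are coherent (★ (c4-b)(i) `map_adelicStableCentralizerEquiv_torusMeasure_eq_of_compactCore`)
  have ht1m₁ : ∀ v, (Measure.map (subgroupCongrHomeomorph (ψ v).symm.toMulEquiv
      (Subgroup.centralizer ({((cmDatum L N H).toLocal v ((cmDatum L N H).toAdelic (Quotient.out c)))} : Set ((cmDatum L N H).Local v))) (Subgroup.centralizer ({(finAdelicEquiv (↥(maximalRealSubfield L)) L (IsCMField.complexConj L) N H) (finPart (↥(maximalRealSubfield L)) L (IsCMField.complexConj L) N H ((cmDatum L N H).toAdelic (Quotient.out c))) v} : Set ↥(localPi L (IsCMField.complexConj L) N H v)))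
      (localPiEquiv_symm_mem_centralizer_iff L N H v ((cmDatum L N H).toAdelic (Quotient.out c)) (ψ v) (congrFun hψ v))
      (ψ v).symm.continuous (ψ v).continuous) (t₁ v)) (compactCore (Subgroup.centralizer ({(finAdelicEquiv (↥(maximalRealSubfield L)) L (IsCMField.complexConj L) N H) (finPart (↥(maximalRealSubfield L)) L (IsCMField.complexConj L) N H ((cmDatum L N H).toAdelic (Quotient.out c))) v} : Set ↥(localPi L (IsCMField.complexConj L) N H v)))) = 1 :=
    fun v => (map_subgroupCongrHomeomorph_apply_compactCore _ _ _ _ _ _ (t₁ v)).trans (ht1c₁ v)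
  have ht1m₂ : ∀ v, (Measure.map (subgroupCongrHomeomorph (ψ v).symm.toMulEquiv
      (Subgroup.centralizer ({((cmDatum L N H).toLocal v ((cmDatum L N H).toAdelic (Quotient.out c')))} : Set ((cmDatum L N H).Local v))) (Subgroup.centralizer ({(finAdelicEquiv (↥(maximalRealSubfield L)) L (IsCMField.complexConj L) N H) (finPart (↥(maximalRealSubfield L)) L (IsCMField.complexConj L) N H ((cmDatum L N H).toAdelic (Quotient.out c'))) v} : Set ↥(localPi L (IsCMField.complexConj L) N H v)))
      (localPiEquiv_symm_mem_centralizer_iff L N H v ((cmDatum L N H).toAdelic (Quotient.out c')) (ψ v) (congrFun hψ v))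
      (ψ v).symm.continuous (ψ v).continuous) (t₂ v)) (compactCore (Subgroup.centralizer ({(finAdelicEquiv (↥(maximalRealSubfield L)) L (IsCMField.complexConj L) N H) (finPart (↥(maximalRealSubfield L)) L (IsCMField.complexConj L) N H ((cmDatum L N H).toAdelic (Quotient.out c'))) v} : Set ↥(localPi L (IsCMField.complexConj L) N H v)))) = 1 :=
    fun v => (map_subgroupCongrHomeomorph_apply_compactCore _ _ _ _ _ _ (t₂ v)).trans (ht1c₂ v)
  have hmap : Measure.map (adelicStableCentralizerEquiv L hHd hHd hcorr hc) tA₁ = tA₂ :=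
    map_adelicStableCentralizerEquiv_torusMeasure_eq_of_compactCore L N H H hHd hHd hcorr hc
      (hCP := fun v => isClosed_coe_centralizer_singleton _) _ S₁ ρ₁ ρM₁ tf₁ ti₁ tP₁ tA₁ e he' he hes (hg _)
      (hCP' := fun v => isClosed_coe_centralizer_singleton _) _ S₂ ρ₂ ρM₂ tf₂ ti₂ tP₂ tA₂ e he' he hes (hg _)
      ht1₁ hρ₁ hρM₁ htf₁ htP₁ htA₁ ht1₂ hρ₂ hρM₂ htf₂ htP₂ htA₂
      (compactCoreCentralizerLevelAE_of_hermitian L N H hH hHd) (compactCoreCentralizerLevelAE_of_hermitian L N H hH hHd)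
      ht1m₁ ht1m₂ hreginf hcinf ha
  -- §7 conclude by ★ (c3′) `covol_eq_of_eq_quotientMeasure_of_map_eq`
  exact covol_eq_of_eq_quotientMeasure_of_map_eq L N H νA νZ hHd m hm c c' hcorr hc tA₁ tA₂
    ((hmreg c hc).trans hof₁) ((hmreg c' hc').trans hof₂) hmap

end Head

end UnitaryGroup

end Literature.NumberTheory.Automorphic
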